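import Summits.BirchSwinnertonDyer.BirchSwinnertonDyer.Theorems.TameQuarticSolventTprimeNoThreeTorsionBaseChange
import Summits.BirchSwinnertonDyer.BirchSwinnertonDyer.Theorems.KimAtThreeFineKatoKPortJunctionDefs
import HarnessLib

/-!
# Route `TameQuarticSolvent`, crux `SolventPairLowerBound` (stmt-BirchSwinnertonDyer-21391) — sub-row B of the
# (t′) leaf: `E(M_w)[3] = 0` at every place `w ∣ 3` of a number field with `e(w∣3) = 4·(odd)`

HONEST FRAMING. Theorems only; helper (`--supports stmt-BirchSwinnertonDyer-21391 --as helper`) of width seat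
bsd-wall-tqs-p1-w2 g7; the number-field-completion instance of `tprime_subrowB_threeTorsion_baseChange_eq_zero`
(p603629) in the K-PORT currency `KPort.Kw p L w` (= `w.1.adicCompletion L` re-normed with base `p`; cell
bsd-addord's `KimAtThreeFineKatoKPortJunctionDefs`). BSD is not proved by any of this; nothing here closes 21391
or 23963 (K1⁻: exact lower BSD₃ over the tame quartic `M`, which this file only informs: on sub-row B the base-changed
curve has no `3`-torsion at the totally ramified place).

WHAT. `tprime_subrowB_threeTorsion_completion_eq_zero`: `W/ℚ` globally minimal, elliptic, `Addv W 3`,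
`SubTprime W 3`, sub-row B (`c₆ = 0 ∨ 2·ord₃ c₆ ≠ ord₃ Δ + 3`); `M` a number field, `w` a place of `M` over `3`
with `e(w∣3) = 4·m'`, `m'` odd (the solvent quartic field of line `birth` and its `3`-cyclotomic layers:
`e = 4, 12, 36, …`). Then **`3 • P = 0 ⇒ P = 0` for every `P ∈ (W ⊗ ℚ₃ ⊗ M_w)(M_w)`**, `M_w = KPort.Kw 3 M w`.
(`ι = algebraMap ℚ_[3] M_w` is integral on `ℤ₃` by `KPort.Kw.norm_algebraMap_padicInt_le_one`; `ϖ` = any element of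
valuation `exp(−m')` (`KPort.Kw.valued_surjective`), so `‖ϖ‖⁴ = 3^{−4m'} = ‖3‖` by `KPort.Kw.valued_natCast_prime`;
the value group is `3^ℤ` by `KPort.Kw.norm_eq_zpow`.)

References: J.-P. Serre, Invent. Math. 15 (1972) §1; J.-P. Serre, *Local Fields* II §1.
[cite: SilvermanAEC2009, IV.6.1] [cite: SerreLocalFields1979, Ch. II §1]
-/

-- D-0017: single-problem summit, so `Summit.BirchSwinnertonDyer.BirchSwinnertonDyer.…` repeats a namespace BY DESIGN.
set_option linter.dupNamespace false

noncomputable section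

namespace Summit.BirchSwinnertonDyer.BirchSwinnertonDyer.Theorems.SolventPairLowerBound

open WeierstrassCurve Literature.NumberTheory.EllipticCurves.Rank1Residual
  Summit.BirchSwinnertonDyer.Rank1Residual.Additive NumberField
  Summit.BirchSwinnertonDyer.BirchSwinnertonDyer.Theorems.KPort

section Completion

/-- **Sub-row B of the (t′) leaf: no `M_w`-rational `3`-torsion at a place `w ∣ 3` with `e(w∣3) = 4·(odd)`.**
See the module docstring. [Serre 1972 §1] [cite: SilvermanAEC2009, IV.6.1] -/
theorem tprime_subrowB_threeTorsion_completion_eq_zero (W : WeierstrassCurve ℚ) [W.IsElliptic]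
    [W.IsGloballyMinimal] (hadd : Addv W 3) (hsub : SubTprime W 3)
    (hB : W.c₆ = 0 ∨ 2 * padicValRat 3 W.c₆ ≠ padicValRat 3 W.Δ + 3)
    (M : Type) [Field M] [NumberField M]
    (w : ((Rat.HeightOneSpectrum.primesEquiv (R := 𝓞 ℚ)).symm ⟨3, Nat.prime_three⟩).Extension (𝓞 M))
    {m' : ℕ} (hm' : Odd m')
    (he : w.1.asIdeal.ramificationIdx (𝓞 ℚ) = 4 * m') [DecidableEq (Kw 3 M w)]
    (P : ((W.baseChange ℚ_[3]).map (algebraMap ℚ_[3] (Kw 3 M w))).toAffine.Point) (h3P : 3 • P = 0) :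
    P = 0 := by
  haveI : Fact (Nat.Prime 3) := ⟨Nat.prime_three⟩
  haveI : IsUltrametricDist (Kw 3 M w) := Kw.isUltrametricDist
  haveI : CharZero (Kw 3 M w) := charZero_of_injective_algebraMap (algebraMap ℚ_[3] (Kw 3 M w)).injective
  -- `ι`, `ϖ`, value group
  have hι : ∀ x : ℤ_[3], ‖algebraMap ℚ_[3] (Kw 3 M w) (x : ℚ_[3])‖ ≤ 1 := fun x ↦
    Kw.norm_algebraMap_padicInt_le_one x
  obtain ⟨ϖ, hϖ⟩ := Kw.valued_surjective (p := 3) (L := M) (w := w)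
    (WithZero.exp (-(m' : ℤ)) : WithZero (Multiplicative ℤ))
  have hm'0 : 0 < m' := hm'.pos
  have hϖnorm : ‖ϖ‖ = (3 : ℝ) ^ (-(m' : ℤ)) := by
    have h := Kw.norm_eq_zpow hϖ
    rw [Nat.cast_ofNat] at h
    exact h
  have hϖ1 : ‖ϖ‖ < 1 := by
    rw [hϖnorm]; exact zpow_lt_one_of_neg₀ (by norm_num) (by omega)
  have hv3 : Valued.v (3 : Kw 3 M w) = (WithZero.exp (-((4 * m' : ℕ) : ℤ)) : WithZero (Multiplicative ℤ)) := by
    have h := Kw.valued_natCast_prime (p := 3) (L := M) (w := w)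
    rw [Nat.cast_ofNat, he] at h
    exact h
  have h3norm : ‖(3 : Kw 3 M w)‖ = (3 : ℝ) ^ (-((4 * m' : ℕ) : ℤ)) := by
    have h := Kw.norm_eq_zpow hv3
    rw [Nat.cast_ofNat] at h
    exact h
  have hϖ4 : ‖ϖ‖ ^ 4 = ‖(3 : Kw 3 M w)‖ := by
    rw [hϖnorm, h3norm, ← zpow_natCast, ← zpow_mul]
    congr 1
    push_cast
    ring
  have hval : ∀ z : Kw 3 M w, z ≠ 0 → ∃ j : ℤ, ‖z‖ ^ m' = ‖ϖ‖ ^ j := by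
    intro z hz
    have hvz : (Valued.v z : WithZero (Multiplicative ℤ)) ≠ 0 := (Valuation.ne_zero_iff _).mpr hz
    obtain ⟨n, hn⟩ : ∃ n : ℤ, Valued.v z = (WithZero.exp n : WithZero (Multiplicative ℤ)) :=
      ⟨WithZero.log (Valued.v z), (WithZero.exp_log hvz).symm⟩
    refine ⟨-n, ?_⟩
    have hzn : ‖z‖ = (3 : ℝ) ^ n := by
      have h := Kw.norm_eq_zpow hn
      rw [Nat.cast_ofNat] at h
      exact h
    rw [hzn, hϖnorm, ← zpow_natCast, ← zpow_mul, ← zpow_mul]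
    congr 1
    ring
  -- the curve `W ⊗ ℚ₃ ⊗ K_w` is `W ⊗ K_w`; transport and conclude
  have hcurve : (W.baseChange ℚ_[3]).map (algebraMap ℚ_[3] (Kw 3 M w)) = W.baseChange (Kw 3 M w) := by
    rw [WeierstrassCurve.baseChange, WeierstrassCurve.map_map, WeierstrassCurve.baseChange]
    congr 1
    exact Subsingleton.elim _ _
  have key : ∀ Q : (W.baseChange (Kw 3 M w)).toAffine.Point, 3 • Q = 0 → Q = 0 := fun Q hQ ↦
    tprime_subrowB_threeTorsion_baseChange_eq_zero W hadd hsub hB (algebraMap ℚ_[3] (Kw 3 M w)) hι ϖ hϖ1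
      hϖ4 hm' hval Q hQ
  rw [← hcurve] at key
  exact key P h3P

end Completion

end Summit.BirchSwinnertonDyer.BirchSwinnertonDyer.Theorems.SolventPairLowerBound

end
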